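import Summits.QuantumFields.GaugeBoot.OneOverNFreeEnergyFirstOrder
import HarnessLib

/-!
# The `1/N` coefficients depend continuously on the coupling (gauge-boot, ADDENDUM 30 part N)

HONEST FRAMING (cell `pub-gaugeboot`, page 1 of every file): the venture produces certified bounds
on lattice expectations at stated coupling, gauge group, dimension and torus size; NOT a mass gap,
NOT a continuum limit, NOT a string tension; NOT Yang–Mills-summit-bearing (barriers
`FixedCouplingUltralocality`, `PerturbativeInvisibility`).  Strong-coupling `SO(N)` lattice gauge theory with free boundary
condition (S. Chatterjee, Comm. Math. Phys. **366** (2019); S. Chatterjee, J. Jafarov, arXiv:1604.04777); nothing about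
four-dimensional continuum Yang–Mills or a mass gap.

## Content

★ `continuousOn_coeff_of` — for any family `F` with the UNIFORM finite-volume bounds of the `1/N` expansion, every coefficient
`β ↦ f_k(β, s)` (`s` a loop sequence in minimal representation) is CONTINUOUS on `[−β₀(d,k+1), β₀(d,k+1)]`: it is the uniform
limit (rate `C_{k+1}L_{k+1}^{|s|}/N`, uniformly in `β`) of the functions `β ↦ N^k(φ_{Λ_N,N,β}(s) − Σ_{i<k} f_i(β,s)N^{−i})`, which are
continuous by induction (`φ` is continuous in the coupling, sibling `PlaquetteAverageLimit`).  The source has more (real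
analyticity, Theorem 7.1, via the string formula — not claimed here).  ★★★ `oneOverN_continuous` packages it with the lane's
coefficients of `oneOverN_master`.

Everything is `[folklore]` given the siblings.
-/

noncomputable section

open Filter Topology
open Literature.Probability.LatticeModels (Site box)
open Literature.MathematicalPhysics.QuantumLattice (ZdEdge ZdPlaquette)
open Literature.MathematicalPhysics.QuantumFieldTheory (latticeNorm)
open Literature.MathematicalPhysics.QuantumFieldTheory.Chatterjee2019LargeN
open Literature.MathematicalPhysics.QuantumFieldTheory.Chatterjee2019LargeN.CoeffCatalanBoundProof

namespace Summit.QuantumFields.GaugeBoot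

namespace StringDuality

variable {d : ℕ}

/-- ★ **Continuity of the coefficients in the coupling**, for any family with the uniform finite-volume bounds.
[cite: ChatterjeeJafarov2016OneOverN, Theorem 3.1 (iii), Theorem 7.1 (the source's stronger analyticity)] -/
theorem continuousOn_coeff_of {F : ℕ → ℝ → LoopSeq d → ℝ} {β₀ C L : ℕ → ℝ} (hanti : ∀ k, β₀ (k + 1) ≤ β₀ k)
    (hQ : ∀ (k : ℕ) (β : ℝ), |β| ≤ β₀ k → ∀ (Λ : Finset (Site d)) (N : ℕ), 2 ≤ N → ∀ s : LoopSeq d, IsLoopSeq s →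
      (∀ l ∈ s, ∀ e ∈ l, ∀ v : Site d,
        latticeNorm (v - DEdge.src e) ≤ ((k * (4 * (Nat.log 2 N + 3)) : ℕ) : ℝ) ∨
          latticeNorm (v - DEdge.tgt e) ≤ ((k * (4 * (Nat.log 2 N + 3)) : ℕ) : ℝ) → v ∈ Λ) →
      |(N : ℝ) ^ k * (phi N β Λ s - ∑ i ∈ Finset.range k, F (i + 2) β s / (N : ℝ) ^ i)| ≤ C k * L k ^ s.len) :
    ∀ (k : ℕ) (s : LoopSeq d), IsLoopSeq s →
      ContinuousOn (fun β : ℝ => F (k + 2) β s) (Set.Icc (-(β₀ (k + 1))) (β₀ (k + 1))) := by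
  -- strong induction on `k`, for a fixed loop sequence
  suffices hmain : ∀ (s : LoopSeq d), IsLoopSeq s → ∀ (k : ℕ) (i : ℕ), i ≤ k →
      ContinuousOn (fun β : ℝ => F (i + 2) β s) (Set.Icc (-(β₀ (k + 1))) (β₀ (k + 1))) from
    fun k s hs => hmain s hs k k le_rfl
  intro s hs
  obtain ⟨r, hr⟩ := exists_vertices_mem_box s
  -- ONE LEVEL: from continuity of the lower coefficients to continuity at level `k`
  have step : ∀ k : ℕ, (∀ j, j < k → ContinuousOn (fun β : ℝ => F (j + 2) β s) (Set.Icc (-(β₀ (k + 1))) (β₀ (k + 1)))) →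
      ContinuousOn (fun β : ℝ => F (k + 2) β s) (Set.Icc (-(β₀ (k + 1))) (β₀ (k + 1))) := by
    intro k hlow
    set R : ℕ → ℕ := fun N => (k + 1) * (4 * (Nat.log 2 N + 3)) with hR
    set h : ℕ → ℝ → ℝ := fun N β => (N : ℝ) ^ k *
      (phi N β (box d (r + R N + 1)) s - ∑ i ∈ Finset.range k, F (i + 2) β s / (N : ℝ) ^ i) with hh
    have hcont : ∀ N : ℕ, ContinuousOn (h N) (Set.Icc (-(β₀ (k + 1))) (β₀ (k + 1))) := by
      intro N
      have h1 : ContinuousOn (fun β : ℝ => phi N β (box d (r + R N + 1)) s) (Set.Icc (-(β₀ (k + 1))) (β₀ (k + 1))) :=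
        (continuous_phi_coupling N (box d (r + R N + 1)) s).continuousOn
      have h2 : ContinuousOn (fun β : ℝ => ∑ i ∈ Finset.range k, F (i + 2) β s / (N : ℝ) ^ i)
          (Set.Icc (-(β₀ (k + 1))) (β₀ (k + 1))) :=
        continuousOn_finsetSum _ fun i hi => (hlow i (Finset.mem_range.mp hi)).div_const _
      exact ((h1.sub h2).const_smul ((N : ℝ) ^ k)).congr fun β _ => by
        simp only [hh, Pi.smul_apply, Pi.sub_apply, smul_eq_mul]
    have hunif : TendstoUniformlyOn h (fun β => F (k + 2) β s) atTop (Set.Icc (-(β₀ (k + 1))) (β₀ (k + 1))) := by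
      rw [Metric.tendstoUniformlyOn_iff]
      intro ε hε
      set A : ℝ := C (k + 1) * L (k + 1) ^ s.len with hA
      have hev : ∀ᶠ N : ℕ in atTop, |A| / (N : ℝ) < ε :=
        (tendsto_const_div_atTop_nhds_zero_nat |A|).eventually (gt_mem_nhds hε)
      filter_upwards [eventually_ge_atTop 2, hev] with N hN2 hεN β hβ
      have hN0 : (0 : ℝ) < N := by exact_mod_cast (by omega : 0 < N)
      have hβ' : |β| ≤ β₀ (k + 1) := abs_le.mpr ⟨hβ.1, hβ.2⟩
      have hdeep := ball_of_vertices_mem_box (n := R N) (M := r + R N + 1) (by omega) hr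
      have hq := hQ (k + 1) β hβ' (box d (r + R N + 1)) N hN2 s hs hdeep
      -- `N^{k+1}(φ − Σ_{i≤k} f_i N^{-i}) = N (h_N(β) − f_k(β))`
      have hid : (N : ℝ) ^ (k + 1) * (phi N β (box d (r + R N + 1)) s -
          ∑ i ∈ Finset.range (k + 1), F (i + 2) β s / (N : ℝ) ^ i) = (N : ℝ) * (h N β - F (k + 2) β s) := by
        rw [Finset.sum_range_succ, hh, pow_succ]
        simp only
        field_simp
        ring
      rw [hid, abs_mul, abs_of_pos hN0] at hq
      rw [Real.dist_eq, abs_sub_comm]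
      have h1 : |h N β - F (k + 2) β s| ≤ |A| / N := by
        rw [le_div_iff₀ hN0, mul_comm]
        exact hq.trans (le_abs_self A)
      exact lt_of_le_of_lt h1 hεN
    exact hunif.continuousOn (Frequently.of_forall hcont)
  intro k
  induction k with
  | zero =>
    intro i hi
    obtain rfl : i = 0 := Nat.le_zero.mp hi
    exact step 0 (fun j hj => (Nat.not_lt_zero j hj).elim)
  | succ k ih =>
    intro i hi
    have hsub : Set.Icc (-(β₀ (k + 1 + 1))) (β₀ (k + 1 + 1)) ⊆ Set.Icc (-(β₀ (k + 1))) (β₀ (k + 1)) :=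
      Set.Icc_subset_Icc (neg_le_neg (hanti (k + 1))) (hanti (k + 1))
    rcases Nat.lt_or_ge i (k + 1) with hik | hik
    · exact (ih i (Nat.lt_succ_iff.mp hik)).mono hsub
    · obtain rfl : i = k + 1 := le_antisymm hi hik
      exact step (k + 1) fun j hj => (ih j (Nat.lt_succ_iff.mp hj)).mono hsub

variable (d)

/-- ★★★ **The coefficients of the `1/N` expansion are continuous in the coupling**, packaged with the lane's coefficients:
there are `β₀(d,0) ≥ β₀(d,1) ≥ ⋯ > 0` and `F` (`f_k = F_{k+2}`; pinned down by the convergence along super-logarithmic cubes) with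
`β ↦ f_k(β, s)` continuous on `[−β₀(d,k+1), β₀(d,k+1)]` for every loop sequence `s` in minimal representation.
[cite: ChatterjeeJafarov2016OneOverN, Theorem 3.1, Theorem 7.1] -/
theorem oneOverN_continuous (hd : 2 ≤ d) :
    ∃ β₀ : ℕ → ℝ, (∀ k, 0 < β₀ k) ∧ (∀ k, β₀ (k + 1) ≤ β₀ k) ∧ ∃ F : ℕ → ℝ → LoopSeq d → ℝ,
      (∀ (k : ℕ) (β : ℝ), |β| ≤ β₀ k → ∀ M : ℕ → ℕ, (∀ a : ℕ, ∀ᶠ N : ℕ in atTop, a * Nat.log 2 N ≤ M N) →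
        ∀ s : LoopSeq d, IsLoopSeq s → Tendsto (fun N : ℕ => (N : ℝ) ^ k *
          (phi N β (box d (M N)) s - ∑ i ∈ Finset.range k, F (i + 2) β s / (N : ℝ) ^ i)) atTop (𝓝 (F (k + 2) β s))) ∧
      (∀ β : ℝ, |β| ≤ β₀ 0 → ∀ s : LoopSeq d, IsLoopSeq s → F 2 β s = ∑' X : Trajectory s, X.weight β) ∧
      ∀ (k : ℕ) (s : LoopSeq d), IsLoopSeq s →
        ContinuousOn (fun β : ℝ => F (k + 2) β s) (Set.Icc (-(β₀ (k + 1))) (β₀ (k + 1))) := by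
  obtain ⟨β₀, hpos, hanti, C, L, -, -, F, -, -, HA, HB, -⟩ := oneOverN_master d hd
  exact ⟨β₀, hpos, hanti, F, fun k β hβ => (HA k β hβ).2.2.2.1, HB,
    continuousOn_coeff_of hanti (fun k β hβ => (HA k β hβ).2.2.2.2.2)⟩

end StringDuality

end Summit.QuantumFields.GaugeBoot

end
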